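import Mathlib
import Literature.Analysis.FluidPDE.SuitableWeak
import Literature.Analysis.FluidPDE.ClassicalSolution
import Literature.Analysis.FluidPDE.NSViscosityRescaling
import Summits.NavierStokesRegularity.NavierStokesRegularity.Theorems.LandauTailLandauTailBlowupCoreEnstrophy

/-!
# Seregin's scaled dissipation diverges at a Landau-tailed blow-up

Helper file for crux `LandauTailBlowup` (stmt-NavierStokesRegularity-1944), line `registered`,
registered stub `landauTail_scaledDissipation_tendsto_top` (B4, "Seregin's scaled dissipation
`E(λ)` diverges").

Setting.  `u` is a classical Navier–Stokes flow on the time interval `(-1, 0)` with a *Landau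
tail* at the space–time origin: the self-similarly rescaled slices
`√(-t) • u t (√(-t) • y)` converge pointwise on `y ≠ 0`, as `t → 0⁻`, to a profile `U` which is
smooth off the origin, `(−1)`-homogeneous, a steady Navier–Stokes flow off the origin, and not
identically zero.

Claim (B4).  Seregin's scaled dissipation of the parabolic cylinders `Q_r = (-r², 0) × B_r`
centred at the singularity,
`E(r) = r⁻¹ ∫∫_{Q_r} |∇u|²` (Caffarelli–Kohn–Nirenberg 1982, (2.5); Seregin 2014, Lecture
Notes, §6), diverges as `r → 0⁺`.

Proof (folklore; Tonelli, parabolic change of variables, Fatou).  By Tonelli and the time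
substitution `t = r² s`,
`E(r) = ∫_{-1}^{0} h_r(s) ds`, `h_r(s) = r ∫_{B_r} |∇u(r² s)|²`
(`landauTail_scaledDissipation_fibre`).  For fixed `s ∈ (-1, 0)` put `t = r² s` and
`ρ = 1/√(-s)`: then `√(-t) = r √(-s)` and `B_r = B_{ρ √(-t)}`, so
`h_r(s) = ρ · [√(-t) ∫_{B_{ρ√(-t)}} |∇u(t)|²]`, which tends to `∞` as `r → 0⁺` by the enstrophy
Type II theorem at the parabolic core (`landauTail_core_dissipation_tendsto_top`, B3')
(`landauTail_scaledDissipation_fibre_tendsto`).  Fatou's lemma along the filter `r → 0⁺` then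
gives `liminf_r E(r) ≥ ∫_{-1}^{0} liminf_r h_r(s) ds = ∞`
(`landauTail_scaledDissipation_tendsto_lintegral_top`).  (The dissipation density is cut off
outside the time slab `(-1, 0)` to make it measurable; this only lowers `E(r)` and changes
nothing for `r < 1`.)

References: L. Caffarelli, R. Kohn, L. Nirenberg, CPAM 35 (1982), (2.5); G. Seregin, *Lecture
Notes on Regularity Theory for the Navier–Stokes Equations* (2014), §6 (scaled energy
quantities); G. Seregin, V. Šverák, *On Type I singularities of the local axi-symmetric
solutions of the Navier–Stokes equations*, CPDE 34 (2009).
-/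

set_option linter.dupNamespace false

namespace Summit.NavierStokesRegularity.NavierStokesRegularity.Theorems

open MeasureTheory Set Filter Metric Topology
open scoped ENNReal NNReal

/-- **Fatou for divergence** [folklore]: if `μ ≠ 0` and a.e. every fibre `i ↦ f i a` tends to
`∞` along a countably generated filter `l`, then so do the integrals `∫⁻ f i ∂μ`
(`∞ = ∫⁻ liminf ≤ liminf ∫⁻`, Mathlib `lintegral_liminf_le'`). -/
theorem landauTail_scaledDissipation_tendsto_lintegral_top {α ι : Type*} [MeasurableSpace α]
    {μ : Measure α} {l : Filter ι} [l.IsCountablyGenerated] [l.NeBot] {f : ι → α → ℝ≥0∞}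
    (hf : ∀ i, AEMeasurable (f i) μ) (hμ : μ univ ≠ 0)
    (h : ∀ᵐ a ∂μ, Tendsto (fun i => f i a) l (𝓝 ⊤)) :
    Tendsto (fun i => ∫⁻ a, f i a ∂μ) l (𝓝 ⊤) := by
  refine tendsto_of_le_liminf_of_limsup_le ?_ le_top
  calc (⊤ : ℝ≥0∞) = ⊤ * μ univ := (ENNReal.top_mul hμ).symm
    _ = ∫⁻ _, (⊤ : ℝ≥0∞) ∂μ := (lintegral_const ⊤).symm
    _ = ∫⁻ a, liminf (fun i => f i a) l ∂μ :=
        lintegral_congr_ae (h.mono fun a ha => ha.liminf_eq.symm)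
    _ ≤ liminf (fun i => ∫⁻ a, f i a ∂μ) l := lintegral_liminf_le' hf

/-- **Time substitution `t = a s` on `(-a, 0)`** [folklore]: for `a > 0`,
`∫_{(-a, 0)} G(t) dt = a ∫_{(-1, 0)} G(a s) ds` (indicators and the whole-line substitution
`Literature.Analysis.FluidPDE.lintegral_comp_mul_left_eq`). -/
theorem landauTail_scaledDissipation_time_subst {a : ℝ} (ha : 0 < a) (G : ℝ → ℝ≥0∞) :
    ∫⁻ t in Ioo (-a) 0, G t = ENNReal.ofReal a * ∫⁻ s in Ioo (-1 : ℝ) 0, G (a * s) := by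
  rw [← lintegral_indicator measurableSet_Ioo, ← lintegral_indicator measurableSet_Ioo]
  have hind : (fun s => (Ioo (-1 : ℝ) 0).indicator (fun s => G (a * s)) s) =
      fun s => (Ioo (-a) 0).indicator G (a * s) := by
    funext s
    by_cases hs : s ∈ Ioo (-1 : ℝ) 0
    · rw [indicator_of_mem hs, indicator_of_mem]
      exact ⟨by nlinarith [hs.1], by nlinarith [hs.2]⟩
    · rw [indicator_of_notMem hs, indicator_of_notMem]
      rintro ⟨h₁, h₂⟩
      exact hs ⟨by nlinarith, by nlinarith⟩
  rw [hind,
    Literature.Analysis.FluidPDE.lintegral_comp_mul_left_eq ((Ioo (-a) 0).indicator G) ha.ne',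
    abs_of_pos (inv_pos.2 ha), ← mul_assoc, ← ENNReal.ofReal_mul ha.le, mul_inv_cancel₀ ha.ne',
    ENNReal.ofReal_one, one_mul]

/-- **Fibre form of the scaled dissipation** [folklore]: Tonelli on the cylinder
`(-r², 0) × B_r` followed by the time substitution `t = r² s`: for measurable `Φ ≥ 0` and
`r > 0`, `r⁻¹ ∫∫_{(-r², 0) × B_r} Φ = ∫_{-1}^{0} (r ∫_{B_r} Φ(r² s, ·)) ds`. -/
theorem landauTail_scaledDissipation_fibre
    (Φ : ℝ × EuclideanSpace ℝ (Fin 3) → ℝ≥0∞) (hΦ : Measurable Φ) {r : ℝ} (hr : 0 < r) :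
    ENNReal.ofReal r⁻¹ * ∫⁻ z in Ioo (-r ^ 2) 0 ×ˢ ball (0 : EuclideanSpace ℝ (Fin 3)) r, Φ z =
      ∫⁻ s in Ioo (-1 : ℝ) 0, ENNReal.ofReal r *
        ∫⁻ x in ball (0 : EuclideanSpace ℝ (Fin 3)) r, Φ (r ^ 2 * s, x) := by
  have hr2 : 0 < r ^ 2 := by positivity
  rw [Measure.volume_eq_prod, ← Measure.prod_restrict, lintegral_prod _ hΦ.aemeasurable,
    landauTail_scaledDissipation_time_subst hr2
      (fun t => ∫⁻ x in ball (0 : EuclideanSpace ℝ (Fin 3)) r, Φ (t, x)),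
    ← mul_assoc, ← ENNReal.ofReal_mul (inv_nonneg.2 hr.le),
    show r⁻¹ * r ^ 2 = r by rw [sq, ← mul_assoc, inv_mul_cancel₀ hr.ne', one_mul],
    lintegral_const_mul' _ _ ENNReal.ofReal_ne_top]

/-- **Measurability of the fibres** [folklore]: for measurable `Φ`, the fibre
`s ↦ r ∫_{B_r} Φ(r² s, ·)` is measurable (Tonelli, Mathlib `Measurable.lintegral_prod_right'`). -/
theorem landauTail_scaledDissipation_fibre_measurable
    (Φ : ℝ × EuclideanSpace ℝ (Fin 3) → ℝ≥0∞) (hΦ : Measurable Φ) (r : ℝ) :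
    Measurable fun s : ℝ => ENNReal.ofReal r *
      ∫⁻ x in ball (0 : EuclideanSpace ℝ (Fin 3)) r, Φ (r ^ 2 * s, x) := by
  have hm : Measurable fun q : ℝ × EuclideanSpace ℝ (Fin 3) => Φ (r ^ 2 * q.1, q.2) :=
    hΦ.comp (by fun_prop)
  exact (hm.lintegral_prod_right'
    (ν := volume.restrict (ball (0 : EuclideanSpace ℝ (Fin 3)) r))).const_mul _

/-- **Parabolic fibres of the core** [folklore]: if `√(-t) · g t (ρ √(-t)) → ∞` as `t → 0⁻` for
every `ρ > 0`, then for every `s < 0`, `r · g (r² s) r → ∞` as `r → 0⁺` (take `ρ = 1/√(-s)` and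
`t = r² s`, so that `√(-t) = r √(-s)` and `ρ √(-t) = r`). -/
theorem landauTail_scaledDissipation_fibre_tendsto (g : ℝ → ℝ → ℝ≥0∞)
    (hg : ∀ ρ : ℝ, 0 < ρ → Tendsto (fun t : ℝ => ENNReal.ofReal (Real.sqrt (-t)) *
      g t (ρ * Real.sqrt (-t))) (𝓝[<] 0) (𝓝 ⊤))
    {s : ℝ} (hs : s < 0) :
    Tendsto (fun r : ℝ => ENNReal.ofReal r * g (r ^ 2 * s) r) (𝓝[>] 0) (𝓝 ⊤) := by
  have hs' : 0 < Real.sqrt (-s) := Real.sqrt_pos.2 (neg_pos.2 hs)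
  have hρ : 0 < (Real.sqrt (-s))⁻¹ := inv_pos.2 hs'
  -- the time map `r ↦ r² s` sends `r → 0⁺` to `t → 0⁻`
  have hφ : Tendsto (fun r : ℝ => r ^ 2 * s) (𝓝[>] 0) (𝓝[<] 0) := by
    refine tendsto_nhdsWithin_iff.2 ⟨?_, eventually_mem_nhdsWithin.mono fun r hr =>
      mul_neg_of_pos_of_neg (pow_pos (mem_Ioi.1 hr) 2) hs⟩
    have hc : Continuous fun r : ℝ => r ^ 2 * s := by fun_prop
    have h0 : Tendsto (fun r : ℝ => r ^ 2 * s) (𝓝 0) (𝓝 0) := by simpa using hc.tendsto 0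
    exact h0.mono_left nhdsWithin_le_nhds
  have h1 := ENNReal.Tendsto.const_mul (a := ENNReal.ofReal (Real.sqrt (-s))⁻¹)
    ((hg _ hρ).comp hφ) (Or.inl ENNReal.top_ne_zero)
  rw [ENNReal.mul_top (ENNReal.ofReal_pos.2 hρ).ne'] at h1
  refine h1.congr' (eventually_mem_nhdsWithin.mono fun r hr => ?_)
  have hr : (0 : ℝ) < r := mem_Ioi.1 hr
  have hsq : Real.sqrt (-(r ^ 2 * s)) = r * Real.sqrt (-s) := by
    rw [show -(r ^ 2 * s) = r ^ 2 * (-s) by ring, Real.sqrt_mul (sq_nonneg r),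
      Real.sqrt_sq hr.le]
  have hρr : (Real.sqrt (-s))⁻¹ * (r * Real.sqrt (-s)) = r := by
    field_simp
  simp only [Function.comp_apply]
  rw [hsq, hρr, ← mul_assoc, ← ENNReal.ofReal_mul hρ.le, hρr]

/-- **B4 — Seregin's scaled dissipation diverges** [folklore; Tonelli + Fatou over the parabolic
fibres] (registered stub B4 of crux `LandauTailBlowup`, stmt-NavierStokesRegularity-1944,
theorem H2).  Let `(u, p)` be a classical Navier–Stokes flow on `(-1, 0) × ℝ³` with a Landau
tail at the origin: `√(-t) • u t (√(-t) • y) → U y` as `t → 0⁻` for every `y ≠ 0`, the profile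
`U` being smooth off `0`, a `(−1)`-homogeneous steady flow off the origin, not identically zero.
Then Seregin's scaled dissipation of the parabolic cylinders at the singularity diverges:
`E(r) = r⁻¹ ∫∫_{Q_r(0,0)} |∇u|² → ∞` as `r → 0⁺` — the blow-up is of Type II in the sense of
the scaled energy `E` as well.  Proof: `E(r) = ∫_{-1}^{0} r ∫_{B_r} |∇u(r² s)|² ds`
(`landauTail_scaledDissipation_fibre`); each fibre is `ρ √(-t) ∫_{B_{ρ√(-t)}} |∇u(t)|²` at
`t = r² s`, `ρ = 1/√(-s)`, divergent by B3' (`landauTail_core_dissipation_tendsto_top`,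
`landauTail_scaledDissipation_fibre_tendsto`); conclude by Fatou
(`landauTail_scaledDissipation_tendsto_lintegral_top`). -/
theorem landauTail_scaledDissipation_tendsto_top : ∀ (u : ℝ → EuclideanSpace ℝ (Fin 3) → EuclideanSpace ℝ (Fin 3)) (p : ℝ → EuclideanSpace ℝ (Fin 3) → ℝ) (U : EuclideanSpace ℝ (Fin 3) → EuclideanSpace ℝ (Fin 3)) (P : EuclideanSpace ℝ (Fin 3) → ℝ), (ContDiffOn ℝ (⊤ : ℕ∞) U {0}ᶜ ∧ ContDiffOn ℝ (⊤ : ℕ∞) P {0}ᶜ ∧ (∀ x : EuclideanSpace ℝ (Fin 3), x ≠ 0 → Literature.Analysis.FluidPDE.convect U U x + gradient P x = (1 : ℝ) • Laplacian.laplacian U x) ∧ (∀ x : EuclideanSpace ℝ (Fin 3), x ≠ 0 → Literature.Analysis.FluidPDE.VectorCalculus.divergence U x = 0) ∧ (∀ c : ℝ, 0 < c → ∀ x : EuclideanSpace ℝ (Fin 3), U (c • x) = c⁻¹ • U x) ∧ (∃ x : EuclideanSpace ℝ (Fin 3), U x ≠ 0)) → Literature.Analysis.FluidPDE.IsClassicalNSSolutionOn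 (Set.Ioo (-1) 0) 1 0 u p → (∀ y : EuclideanSpace ℝ (Fin 3), y ≠ 0 → Filter.Tendsto (fun t : ℝ => Real.sqrt (0 - t) • u t (Real.sqrt (0 - t) • y)) (nhdsWithin 0 (Set.Iio 0)) (nhds (U y))) → Filter.Tendsto (fun r : ℝ => ENNReal.ofReal r⁻¹ * ∫⁻ z in Literature.Analysis.FluidPDE.parabolicCylinder r ((0 : ℝ), (0 : EuclideanSpace ℝ (Fin 3))), ENNReal.ofReal (Literature.Analysis.FluidPDE.frobeniusNormSq (fderiv ℝ (u z.1) z.2))) (nhdsWithin 0 (Set.Ioi 0)) (nhds ⊤) := by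
  intro u p U P hprof hcl htail
  have hB := landauTail_core_dissipation_tendsto_top u p U P hprof hcl htail
  -- the dissipation density `F`, and its cut-off `F'` outside the time slab `(-1, 0)`
  obtain ⟨F, hF⟩ : ∃ F : ℝ × EuclideanSpace ℝ (Fin 3) → ℝ≥0∞, F = fun z =>
      ENNReal.ofReal (Literature.Analysis.FluidPDE.frobeniusNormSq (fderiv ℝ (u z.1) z.2)) :=
    ⟨_, rfl⟩
  have hcont : ContinuousOn F (Ioo (-1 : ℝ) 0 ×ˢ univ) := by
    rw [hF]
    have h := hcl.smooth_velocity.continuousOn_fderiv_slice (uniqueDiffOn_Ioo (-1) 0)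
    refine ENNReal.continuous_ofReal.comp_continuousOn ?_
    unfold Literature.Analysis.FluidPDE.frobeniusNormSq
    exact continuousOn_finsetSum _ fun i _ => ((h.clm_apply continuousOn_const).norm).pow 2
  classical
  obtain ⟨F', hF'⟩ : ∃ F' : ℝ × EuclideanSpace ℝ (Fin 3) → ℝ≥0∞,
      F' = (Ioo (-1 : ℝ) 0 ×ˢ (univ : Set (EuclideanSpace ℝ (Fin 3)))).indicator F :=
    ⟨_, rfl⟩
  have hF'm : Measurable F' := by
    rw [hF', ← Set.piecewise_eq_indicator]
    exact hcont.measurable_piecewise continuousOn_const (measurableSet_Ioo.prod MeasurableSet.univ)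
  have hle : ∀ z, F' z ≤ F z := fun z => by
    rw [hF']
    exact indicator_le_self _ _ z
  have heq : ∀ t ∈ Ioo (-1 : ℝ) 0, ∀ x : EuclideanSpace ℝ (Fin 3), F' (t, x) = F (t, x) :=
    fun t ht x => by rw [hF', indicator_of_mem (mk_mem_prod ht (mem_univ x))]
  -- B3' for the cut-off density
  have hg : ∀ ρ : ℝ, 0 < ρ → Tendsto (fun t : ℝ => ENNReal.ofReal (Real.sqrt (-t)) *
      ∫⁻ x in ball (0 : EuclideanSpace ℝ (Fin 3)) (ρ * Real.sqrt (-t)), F' (t, x))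
      (𝓝[<] 0) (𝓝 ⊤) := by
    intro ρ hρ
    refine (hB ρ hρ).congr' ?_
    filter_upwards [Ioo_mem_nhdsLT (show (-1 : ℝ) < 0 by norm_num)] with t ht
    refine congrArg _ (lintegral_congr fun x => ?_)
    rw [heq t ht x, hF]
  -- the fibres `h r s = r ∫_{B_r} F'(r² s, ·)` diverge for every `s ∈ (-1, 0)` ...
  have hfib : ∀ s ∈ Ioo (-1 : ℝ) 0, Tendsto (fun r : ℝ => ENNReal.ofReal r *
      ∫⁻ x in ball (0 : EuclideanSpace ℝ (Fin 3)) r, F' (r ^ 2 * s, x)) (𝓝[>] 0) (𝓝 ⊤) :=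
    fun s hs => landauTail_scaledDissipation_fibre_tendsto
      (fun t R => ∫⁻ x in ball (0 : EuclideanSpace ℝ (Fin 3)) R, F' (t, x)) hg hs.2
  -- ... hence so does their time integral (Fatou) ...
  have hint : Tendsto (fun r : ℝ => ∫⁻ s in Ioo (-1 : ℝ) 0, ENNReal.ofReal r *
      ∫⁻ x in ball (0 : EuclideanSpace ℝ (Fin 3)) r, F' (r ^ 2 * s, x)) (𝓝[>] 0) (𝓝 ⊤) := by
    refine landauTail_scaledDissipation_tendsto_lintegral_top
      (fun r => (landauTail_scaledDissipation_fibre_measurable F' hF'm r).aemeasurable) ?_ ?_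
    · rw [Measure.restrict_apply_univ, Real.volume_Ioo]
      norm_num
    · exact (ae_restrict_mem measurableSet_Ioo).mono fun s hs => hfib s hs
  -- ... which is the scaled dissipation of `F'`, at most that of `F`
  have hE' : Tendsto (fun r : ℝ => ENNReal.ofReal r⁻¹ *
      ∫⁻ z in Ioo (-r ^ 2) 0 ×ˢ ball (0 : EuclideanSpace ℝ (Fin 3)) r, F' z)
      (𝓝[>] 0) (𝓝 ⊤) := by
    refine hint.congr' ?_
    filter_upwards [self_mem_nhdsWithin] with r hr
    exact (landauTail_scaledDissipation_fibre F' hF'm (mem_Ioi.1 hr)).symm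
  refine tendsto_nhds_top_mono hE' (Eventually.of_forall fun r => ?_)
  simp only [Literature.Analysis.FluidPDE.parabolicCylinder, zero_sub]
  refine mul_le_mul_right (lintegral_mono fun z => ?_) _
  rw [hF] at hle
  exact hle z

end Summit.NavierStokesRegularity.NavierStokesRegularity.Theorems
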